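import Summits.QuantumFields.YangMills.Theorems.BalabanUVNodesN15CovariantSandwichLetters
import Summits.QuantumFields.YangMills.Theorems.BalabanUVNodesN15SmallFieldUnitLayerDirichlet
import HarnessLib

/-!
# N15 = NE2 — PROGRAMME Q «COVARIANT AVERAGE IN THE SANDWICH», part (Q-4): ★★★ THE UNIT LAYER WITH A COVARIANTLY PERTURBED AVERAGING AND A GENUINE DIRICHLET REGION — `NE2PlusUnit` BY NAME
# for the U-live coloured (2.156) covariance `C^{(k)}_Λ(U)` whose dressed effective form carries the covariantly averaged middle factor `zCov` ((Q-2)), for ANY perturbation family of [B9]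
# (3.81)'s size with an η-defect of rate `(L^k)^{−1∕16}` (rows DISPLAYED), constants uniform in the region `Λ`
# (dag-n15-a g31, FILE (Q-4); node N15 = NE2; `--supports stmt-QuantumFields-27366 --as helper`, count-neutral; one plumbing `def` + theorems; imports (Q-2), (Ð-4))

WHY.  (Ð-4) `ne2PlusUnit_foCovSfLam` is the node's unit conjunct for dag-n15-c's live family with the genuine Dirichlet region, its middle factor averaging FLATLY ((J-b′) `zLive`).  [B9] §E's
`C^{(k)}_Λ(U)` is built from the covariantly averaged objects (the averaging `Q(U)` of (3.14)–(3.15) ∕ [5] (124), background dependence (3.78)–(3.81)).  This file is (Ð-4) with the middle factor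
`zCov` of (Q-2) — the averaging `Q⊗1 + D`, `Q*⊗1 + E` — for EVERY perturbation family with the DISPLAYED rows of (Q-3) (sizes `K_D·(c₃₅L^mα₀)·e^{−ρd}` ([B9] (3.81)'s shape), two-grid comparison
`K_D·(L^k)^{−1∕16}·e^{−ρd}`, at every rate with a rate-dependent `K_D`, in a small-field window `c₃₅L^mα₀ ≤ s₀` of the family's choosing).  Intended instance: n15-c∕181's `qvCov`∕`qvCovAdj` minus the flat pair (rows = n15-c∕182 + a comparison sequel), by `exact`.

WHAT.  §1 def `foCovCovLam … Dc Ec Df Ef i Λ′₀` ((Ð-4) `foCovSfLam` with `zCovF∕zCovC` in place of `zLiveF∕zLiveC`), `foCovCovLam_ker`, ★ `foCovCovLam_zero_family` (with the zero family it IS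
(Ð-4)'s kernel), ★ `foCovCovLam_ker_eq_zero_of_not_isLam` (Dirichlet: the kernel vanishes off `Λ`).  §2 ★★★ **`ne2PlusUnit_foCovCovLam`**: `d ≥ 1`, odd `L ≥ 7`, `a, c₃₅ > 0`,
trace-form-orthonormal `e`, `ι` nonempty, a perturbation family with the displayed rows ⟹ `∃ w, NE2PlusUnit c₃₅ (sfInstance ∘ ·.1.1) (foCovCovLam … ·.1.1 ·.2) (inLamSf … ·.1.1 ·.2) dist` on
`SfIdxGE d L w × Finset (Fin (d+1) → ℤ)` with ONE set of constants `(δ₀, a₀, B₀, θ = L^{−1∕16})` — (Ð-4)'s chain verbatim ((H) `exDress_deltaCol_letters` → (Ð-3) `covCS_rate_king`) fed by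
(Q-2) `exists_zCov_letters`; thresholds = (Ð-4)'s plus `K_D c₃₅ a₀ ≤ K_D∕(K_D+1)`, the Combes–Thomas and (2.153) margins at `ζ = K(κ_e + 2K_D)r_A`.

HONEST FRAMING ∕ LIMITS.  The covariant averaging is MODELLED as `Q⊗1 + D` with `D`'s rows DISPLAYED — the object `Q(U)` is NOT constructed or instantiated HERE (n15-c∕181 `qvCov` is the
intended instance; [5] (124) not typed); MODEL carriers of n15-c FILE 130∕133∕145 and (J-b′)(H)(L-1)…(L-3)(Ð-1)…(Ð-3) (global small-field gauge `u ≡ 1`; covariant Laplacian (3.50) ⊗ colour +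
FLAT nonlocal part (1.69) — not (3.26); `Reg336` idle ∕ no `D^{(2)}` term of (3.156); King-block-mean pairing; doubled torus; `L ≥ 7`; large cubes `L^m ≥ w` = print's «M ≥ M₁»; crude constants).
NOT [B9] Thm 3.15 AS PRINTED.  No layer knit here; N15 stays DISCHARGED OF RECORD AS CONSUMED (U-blind v7 pin, p687738) — no re-pin asked, nothing re-claimed, no count moved (typed 28∕28 ·
discharged 8∕28); K3⁸ OPEN; finite 𝕋⁴ per index — NOT ℝ⁴ ∕ OS ∕ mass gap ∕ Clay.  One plumbing `def` ⇒ review ∕ audit lane.  `set_option maxHeartbeats 800000 in` ×1 ((Ð-4)'s budget).  No `sorry`,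
`instance`, `notation`; standard axioms.
[cite: Balaban1985BackgroundPropagators, Thm 3.15 (3.185)–(3.187) p.432 (quantifier template, object `C^{(k)}_Λ(U)`, constants depend on d, L only), §E pp.427–428, (3.78)–(3.81) p.406, (3.35) p.396; Balaban1984PropagatorsII,
(2.153)–(2.157) pp.249–250; Balaban1985Averaging, (122)–(126) p.36 (NOT typed); King1986, Lemma 4.5 (4.38)–(4.41) pp.674–675 (shape, mechanism); CombesThomas1973, §II (mechanism)]
-/

noncomputable section

open scoped BigOperators Matrix Matrix.Norms.Frobenius Kronecker

namespace Summit.QuantumFields.YangMills.BalabanUVNodes.N15.SiteLayerSf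

open Literature.MathematicalPhysics.QuantumFieldTheory.Balaban1983to89
open Literature.MathematicalPhysics.QuantumFieldTheory.King1986 (exp_decay_mono)
open Literature.MathematicalPhysics.QuantumFieldTheory.Balaban1983to89.T4EtaRate (PairedInstance NE2PlusUnit EtaRateIneqUnit)
open Literature.MathematicalPhysics.QuantumFieldTheory.Balaban1983to89.T4EtaRateCoeffDefect (pull)
open Literature.MathematicalPhysics.QuantumFieldTheory.Balaban1983to89.B11SectG (BlockNorm HasMaj)
open Literature.MathematicalPhysics.QuantumFieldTheory.Balaban1983to89.B5Prop11Plancherel (Tor fine)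
open Literature.MathematicalPhysics.QuantumFieldTheory.Balaban1983to89.B6Lemma24Torus (pbox coarseSites)
open Literature.MathematicalPhysics.QuantumFieldTheory.Balaban1983to89.B6BondEliminationTorus (pdist)
open Literature.MathematicalPhysics.QuantumFieldTheory.Balaban1983to89.B6Cov2156Torus (deltaPol one_le_M freeT)
open Literature.MathematicalPhysics.QuantumFieldTheory.Balaban1983to89.B6Cov2156TorusSubset (IsLam lamFree lamFree_subset)
open Literature.MathematicalPhysics.QuantumFieldTheory.Balaban1983to89.B6LowerBound2153Torus (rep rep_mem_pbox InLam)
open Literature.MathematicalPhysics.QuantumFieldTheory.Balaban1983to89.B6UnitTorusCarrier (unitTorusGeo pdist_rep_rep)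
open Literature.MathematicalPhysics.QuantumFieldTheory.King1986.Torus (blockOf tdistT tdistT_nonneg)
open Literature.Barriers.QuantumFields (traceForm)
open Summit.QuantumFields.YangMills.BalabanUVNodes.N15.VectorPiece (bshiftEquiv kingPrV tensorId unitTorusGeoS)
open Summit.QuantumFields.YangMills.BalabanUVNodes.N15.MatrixSpecies (basisConst basisConst_nonneg liftBlk liftMap)
open Summit.QuantumFields.YangMills.BalabanUVNodes.N15.UnitLayerBg (exDress exDress_zero)
open Summit.QuantumFields.YangMills.BalabanUVNodes.N15.UnitLayerBgCol (cdist cdist_eq cdist_nonneg covC covCS covCS_lamFree_eq_covC covCS_lamFree_apply_eq_zero covCS_rate_king epsCovC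
  epsCovC_pos exDress_deltaCol_letters)
open Summit.QuantumFields.YangMills.BalabanUVNodes.N15.Gluing (SfIdx sfGeo sfInstance sfInstance_reg335_iff sfInstance_gf_M CvX CvX' cvM cvBlk CvNorm)
open Summit.QuantumFields.YangMills.BalabanUVNodes.N15.GluedZeroField (zCovC zCovF zCovC_zero_zero zCovF_zero_zero exists_zCov_letters)

variable (d : ℕ) {L : ℕ} [NeZero L] (mm ι : Type) [Fintype mm] [DecidableEq mm] [Fintype ι] [DecidableEq ι] (a : ℝ) (e : Matrix mm mm ℂ ≃L[ℝ] (ι → ℝ))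

/-! ## §1 The U-live Dirichlet unit kernel with a perturbed averaging -/

section Kernel

/-- ★ **THE U-LIVE DIRICHLET UNIT-LAYER η-DIFFERENCE KERNEL WITH A PERTURBED AVERAGING**: (Ð-4)'s `foCovSfLam` with the covariantly averaged middle factors `zCovF A′ (Df i A′) (Ef i A′)`,
`zCovC A′ (Dc i A′) (Ec i A′)` of (Q-2) in the dressed effective forms — the model's `C^{(k)}_Λ(U)` read at the coloured unit bonds `((ȳ,α),j)`, `((ȳ′,β),j′)`.
[cite: Balaban1985BackgroundPropagators, Thm 3.15 (3.185)–(3.187) p.432 (object, shape), (3.155)–(3.158) p.428, (3.78)–(3.81) p.406; Balaban1984PropagatorsII, (2.156) p.250] -/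
def foCovCovLam (hL : Odd L ∧ 1 < L) (α β : Fin (d + 1)) (j j' : ι)
    (Dc : ∀ i : SfIdx d L, (Fin (d + 1) → CvX' d L i.m i.kk i.r hL → Matrix mm mm ℂ) → ((CvX d L i.m i.kk hL × ι → ℝ) →ₗ[ℝ] ((Tor (cvM d L i.m i.kk hL) × Fin (d + 1)) × ι → ℝ)))
    (Ec : ∀ i : SfIdx d L, (Fin (d + 1) → CvX' d L i.m i.kk i.r hL → Matrix mm mm ℂ) → (((Tor (cvM d L i.m i.kk hL) × Fin (d + 1)) × ι → ℝ) →ₗ[ℝ] (CvX d L i.m i.kk hL × ι → ℝ)))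
    (Df : ∀ i : SfIdx d L, (Fin (d + 1) → CvX' d L i.m i.kk i.r hL → Matrix mm mm ℂ) → ((CvX' d L i.m i.kk i.r hL × ι → ℝ) →ₗ[ℝ] ((Tor (cvM d L i.m i.kk hL) × Fin (d + 1)) × ι → ℝ)))
    (Ef : ∀ i : SfIdx d L, (Fin (d + 1) → CvX' d L i.m i.kk i.r hL → Matrix mm mm ℂ) → (((Tor (cvM d L i.m i.kk hL) × Fin (d + 1)) × ι → ℝ) →ₗ[ℝ] (CvX' d L i.m i.kk i.r hL × ι → ℝ)))
    (i : SfIdx d L) (Λ'₀ : Finset (Fin (d + 1) → ℤ)) : B9.SiteKernel (sfInstance d mm ι hL i).gc (sfInstance d mm ι hL i).Bf :=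
  ⟨fun A' y y' =>
    covCS L (cvM d L i.m i.kk hL) ι (lamFree L (cvM d L i.m i.kk hL) Λ'₀) (lamFree_subset L (cvM d L i.m i.kk hL) Λ'₀)
        (deltaPol (cvM d L i.m i.kk hL) (L ^ i.r * L ^ i.kk) ⊗ₖ (1 : Matrix ι ι ℝ) +
          exDress a (deltaPol (cvM d L i.m i.kk hL) (L ^ i.r * L ^ i.kk) ⊗ₖ (1 : Matrix ι ι ℝ)) (zCovF d mm ι a e hL i.m i.kk i.r A' (Df i A') (Ef i A')))
        ((⟨rep (cvM d L i.m i.kk hL) y, rep_mem_pbox (cvM d L i.m i.kk hL) y⟩, α), j) ((⟨rep (cvM d L i.m i.kk hL) y', rep_mem_pbox (cvM d L i.m i.kk hL) y'⟩, β), j')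
      - covCS L (cvM d L i.m i.kk hL) ι (lamFree L (cvM d L i.m i.kk hL) Λ'₀) (lamFree_subset L (cvM d L i.m i.kk hL) Λ'₀)
        (deltaPol (cvM d L i.m i.kk hL) (L ^ i.kk) ⊗ₖ (1 : Matrix ι ι ℝ) +
          exDress a (deltaPol (cvM d L i.m i.kk hL) (L ^ i.kk) ⊗ₖ (1 : Matrix ι ι ℝ)) (zCovC d mm ι a e hL i.m i.kk i.r A' (Dc i A') (Ec i A')))
        ((⟨rep (cvM d L i.m i.kk hL) y, rep_mem_pbox (cvM d L i.m i.kk hL) y⟩, α), j) ((⟨rep (cvM d L i.m i.kk hL) y', rep_mem_pbox (cvM d L i.m i.kk hL) y'⟩, β), j')⟩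

/-- Unfolding of `foCovCovLam`. [folklore] -/
theorem foCovCovLam_ker (hL : Odd L ∧ 1 < L) (α β : Fin (d + 1)) (j j' : ι)
    (Dc : ∀ i : SfIdx d L, (Fin (d + 1) → CvX' d L i.m i.kk i.r hL → Matrix mm mm ℂ) → ((CvX d L i.m i.kk hL × ι → ℝ) →ₗ[ℝ] ((Tor (cvM d L i.m i.kk hL) × Fin (d + 1)) × ι → ℝ)))
    (Ec : ∀ i : SfIdx d L, (Fin (d + 1) → CvX' d L i.m i.kk i.r hL → Matrix mm mm ℂ) → (((Tor (cvM d L i.m i.kk hL) × Fin (d + 1)) × ι → ℝ) →ₗ[ℝ] (CvX d L i.m i.kk hL × ι → ℝ)))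
    (Df : ∀ i : SfIdx d L, (Fin (d + 1) → CvX' d L i.m i.kk i.r hL → Matrix mm mm ℂ) → ((CvX' d L i.m i.kk i.r hL × ι → ℝ) →ₗ[ℝ] ((Tor (cvM d L i.m i.kk hL) × Fin (d + 1)) × ι → ℝ)))
    (Ef : ∀ i : SfIdx d L, (Fin (d + 1) → CvX' d L i.m i.kk i.r hL → Matrix mm mm ℂ) → (((Tor (cvM d L i.m i.kk hL) × Fin (d + 1)) × ι → ℝ) →ₗ[ℝ] (CvX' d L i.m i.kk i.r hL × ι → ℝ)))
    (i : SfIdx d L) (Λ'₀ : Finset (Fin (d + 1) → ℤ)) (A' : Fin (d + 1) → CvX' d L i.m i.kk i.r hL → Matrix mm mm ℂ) (y y' : Tor (cvM d L i.m i.kk hL)) :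
    (foCovCovLam d mm ι a e hL α β j j' Dc Ec Df Ef i Λ'₀).ker A' y y' =
      covCS L (cvM d L i.m i.kk hL) ι (lamFree L (cvM d L i.m i.kk hL) Λ'₀) (lamFree_subset L (cvM d L i.m i.kk hL) Λ'₀)
        (deltaPol (cvM d L i.m i.kk hL) (L ^ i.r * L ^ i.kk) ⊗ₖ (1 : Matrix ι ι ℝ) +
          exDress a (deltaPol (cvM d L i.m i.kk hL) (L ^ i.r * L ^ i.kk) ⊗ₖ (1 : Matrix ι ι ℝ)) (zCovF d mm ι a e hL i.m i.kk i.r A' (Df i A') (Ef i A')))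
        ((⟨rep (cvM d L i.m i.kk hL) y, rep_mem_pbox (cvM d L i.m i.kk hL) y⟩, α), j) ((⟨rep (cvM d L i.m i.kk hL) y', rep_mem_pbox (cvM d L i.m i.kk hL) y'⟩, β), j')
      - covCS L (cvM d L i.m i.kk hL) ι (lamFree L (cvM d L i.m i.kk hL) Λ'₀) (lamFree_subset L (cvM d L i.m i.kk hL) Λ'₀)
        (deltaPol (cvM d L i.m i.kk hL) (L ^ i.kk) ⊗ₖ (1 : Matrix ι ι ℝ) +
          exDress a (deltaPol (cvM d L i.m i.kk hL) (L ^ i.kk) ⊗ₖ (1 : Matrix ι ι ℝ)) (zCovC d mm ι a e hL i.m i.kk i.r A' (Dc i A') (Ec i A')))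
        ((⟨rep (cvM d L i.m i.kk hL) y, rep_mem_pbox (cvM d L i.m i.kk hL) y⟩, α), j) ((⟨rep (cvM d L i.m i.kk hL) y', rep_mem_pbox (cvM d L i.m i.kk hL) y'⟩, β), j') := rfl

/-- ★ **CONSISTENCY — WITH THE ZERO PERTURBATION FAMILY THE KERNEL IS (Ð-4)'s FLATLY AVERAGED `foCovSfLam`.** [bookkeeping] -/
theorem foCovCovLam_zero_family (hL : Odd L ∧ 1 < L) (α β : Fin (d + 1)) (j j' : ι) (i : SfIdx d L) (Λ'₀ : Finset (Fin (d + 1) → ℤ))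
    (A' : Fin (d + 1) → CvX' d L i.m i.kk i.r hL → Matrix mm mm ℂ) (y y' : Tor (cvM d L i.m i.kk hL)) :
    (foCovCovLam d mm ι a e hL α β j j' (fun _ _ => 0) (fun _ _ => 0) (fun _ _ => 0) (fun _ _ => 0) i Λ'₀).ker A' y y' = (foCovSfLam d mm ι a e hL α β j j' i Λ'₀).ker A' y y' := by
  rw [foCovCovLam_ker, foCovSfLam_ker, zCovC_zero_zero, zCovF_zero_zero]

/-- ★ **DIRICHLET — OUTSIDE THE REGION THE KERNEL VANISHES** (whatever the potential and the perturbation family): if the unit bond `(ȳ, α)` does NOT meet `Λ = B(Λ′₀)` then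
`(foCovCovLam … i Λ'₀).ker A′ y y′ = 0` ((Ð-1) `covCS_lamFree_apply_eq_zero`). [cite: Balaban1984PropagatorsII, p.250 («CB′ = 0 outside Λ»); Balaban1985BackgroundPropagators, §E p.428] -/
theorem foCovCovLam_ker_eq_zero_of_not_isLam (hL : Odd L ∧ 1 < L) (α β : Fin (d + 1)) (j j' : ι)
    (Dc : ∀ i : SfIdx d L, (Fin (d + 1) → CvX' d L i.m i.kk i.r hL → Matrix mm mm ℂ) → ((CvX d L i.m i.kk hL × ι → ℝ) →ₗ[ℝ] ((Tor (cvM d L i.m i.kk hL) × Fin (d + 1)) × ι → ℝ)))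
    (Ec : ∀ i : SfIdx d L, (Fin (d + 1) → CvX' d L i.m i.kk i.r hL → Matrix mm mm ℂ) → (((Tor (cvM d L i.m i.kk hL) × Fin (d + 1)) × ι → ℝ) →ₗ[ℝ] (CvX d L i.m i.kk hL × ι → ℝ)))
    (Df : ∀ i : SfIdx d L, (Fin (d + 1) → CvX' d L i.m i.kk i.r hL → Matrix mm mm ℂ) → ((CvX' d L i.m i.kk i.r hL × ι → ℝ) →ₗ[ℝ] ((Tor (cvM d L i.m i.kk hL) × Fin (d + 1)) × ι → ℝ)))
    (Ef : ∀ i : SfIdx d L, (Fin (d + 1) → CvX' d L i.m i.kk i.r hL → Matrix mm mm ℂ) → (((Tor (cvM d L i.m i.kk hL) × Fin (d + 1)) × ι → ℝ) →ₗ[ℝ] (CvX' d L i.m i.kk i.r hL × ι → ℝ)))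
    (i : SfIdx d L) (Λ'₀ : Finset (Fin (d + 1) → ℤ)) (A' : Fin (d + 1) → CvX' d L i.m i.kk i.r hL → Matrix mm mm ℂ) {y : Tor (cvM d L i.m i.kk hL)}
    (hy : ¬ IsLam L (cvM d L i.m i.kk hL) Λ'₀ (⟨rep (cvM d L i.m i.kk hL) y, rep_mem_pbox (cvM d L i.m i.kk hL) y⟩, α)) (y' : Tor (cvM d L i.m i.kk hL)) :
    (foCovCovLam d mm ι a e hL α β j j' Dc Ec Df Ef i Λ'₀).ker A' y y' = 0 := by
  have hLpos : 0 < L := Nat.pos_of_ne_zero (NeZero.ne L)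
  have hLMdvd : ∀ μ, L ∣ cvM d L i.m i.kk hL μ := fun μ => by
    show L ∣ 2 * L ^ (i.m + 1)
    exact Dvd.dvd.mul_left (dvd_pow_self L (Nat.succ_ne_zero _)) 2
  rw [foCovCovLam_ker, covCS_lamFree_apply_eq_zero hLpos hLMdvd Λ'₀ _ (p := ((⟨rep (cvM d L i.m i.kk hL) y, rep_mem_pbox (cvM d L i.m i.kk hL) y⟩, α), j)) hy,
    covCS_lamFree_apply_eq_zero hLpos hLMdvd Λ'₀ _ (p := ((⟨rep (cvM d L i.m i.kk hL) y, rep_mem_pbox (cvM d L i.m i.kk hL) y⟩, α), j)) hy, sub_self]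

end Kernel

/-! ## §2 ★★★ `NE2PlusUnit` by name with a genuine Dirichlet region and a perturbed averaging -/

section UnitLayer

set_option maxHeartbeats 800000 in
/-- ★★★ **`NE2PlusUnit` — THE NODE's THIRD CONJUNCT BY NAME — FOR THE U-LIVE COLOURED (2.156) DIRICHLET COVARIANCE WITH A PERTURBED AVERAGING, ON dag-n15-c's LIVE FAMILY** (large cubes ×
ALL regions).  For `d ≥ 1`, odd `L ≥ 7`, `a, c₃₅ > 0`, a trace-form-orthonormal `e` (`ι` nonempty), directions `α β`, colours `j j′`, and a perturbation family `(Dc, Ec, Df, Ef)` with the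
DISPLAYED rows (every rate `ρ > 0`; sizes `K_D·(c₃₅L^mα₀)·e^{−ρd}`, comparison `K_D·(L^k)^{−1∕16}·e^{−ρd}` under `Reg335 c₃₅ α₀ A′`): there is `w` such that on `SfIdxGE d L w × Finset (Fin (d+1) → ℤ)`
`NE2PlusUnit c₃₅ (sfInstance ∘ ·.1.1) (foCovCovLam … ·.1.1 ·.2) inLamSf dist` holds with ONE set of constants `(δ₀, a₀, B₀, θ = L^{−1∕16})` — the constants do not see the region.  Chain = (Ð-4)'s
verbatim with (Q-2) `exists_zCov_letters` in place of (J-b′).  MODEL objects; NOT [B9] Thm 3.15 as printed.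
[cite: Balaban1985BackgroundPropagators, Thm 3.15 (3.185)–(3.187) p.432 (quantifier template, shape, constants depend on d, L only), §E pp.427–428, (3.78)–(3.81) p.406, (3.35) p.396; Balaban1984PropagatorsII, (2.153)–(2.157) pp.249–250;
King1986, Lemma 4.5 (4.38)–(4.41) pp.674–675 (shape, mechanism); CombesThomas1973, §II (mechanism)] -/
theorem ne2PlusUnit_foCovCovLam [Nonempty ι] (hd : 1 ≤ d) (hL : Odd L ∧ 1 < L) (hL7 : 7 ≤ L) (ha : 0 < a) {c35 : ℝ} (hc35 : 0 < c35)
    (he : ∀ A B : Matrix mm mm ℂ, traceForm A B = e A ⬝ᵥ e B) (α β : Fin (d + 1)) (j j' : ι)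
    (Dc : ∀ i : SfIdx d L, (Fin (d + 1) → CvX' d L i.m i.kk i.r hL → Matrix mm mm ℂ) → ((CvX d L i.m i.kk hL × ι → ℝ) →ₗ[ℝ] ((Tor (cvM d L i.m i.kk hL) × Fin (d + 1)) × ι → ℝ)))
    (Ec : ∀ i : SfIdx d L, (Fin (d + 1) → CvX' d L i.m i.kk i.r hL → Matrix mm mm ℂ) → (((Tor (cvM d L i.m i.kk hL) × Fin (d + 1)) × ι → ℝ) →ₗ[ℝ] (CvX d L i.m i.kk hL × ι → ℝ)))
    (Df : ∀ i : SfIdx d L, (Fin (d + 1) → CvX' d L i.m i.kk i.r hL → Matrix mm mm ℂ) → ((CvX' d L i.m i.kk i.r hL × ι → ℝ) →ₗ[ℝ] ((Tor (cvM d L i.m i.kk hL) × Fin (d + 1)) × ι → ℝ)))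
    (Ef : ∀ i : SfIdx d L, (Fin (d + 1) → CvX' d L i.m i.kk i.r hL → Matrix mm mm ℂ) → (((Tor (cvM d L i.m i.kk hL) × Fin (d + 1)) × ι → ℝ) →ₗ[ℝ] (CvX' d L i.m i.kk i.r hL × ι → ℝ)))
    (hfam : ∀ ρ : ℝ, 0 < ρ → ∃ KD s₀ : ℝ, 0 ≤ KD ∧ 0 < s₀ ∧
      ∀ (i : SfIdx d L) (α₀ : ℝ) (A' : Fin (d + 1) → CvX' d L i.m i.kk i.r hL → Matrix mm mm ℂ), 0 < α₀ → c35 * (L : ℝ) ^ i.m * α₀ ≤ s₀ → (sfInstance d mm ι hL i).Bf.Reg335 c35 α₀ A' →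
        HasMaj (CvNorm d L i.m i.kk hL ι) (BlockNorm.ofBlocks (unitTorusGeo L i.kk (cvM d L i.m i.kk hL)) (liftBlk (fun b : Tor (cvM d L i.m i.kk hL) × Fin (d + 1) => b.1) ι)) (Dc i A')
          (fun y y' => KD * (c35 * (L : ℝ) ^ i.m * α₀) * Real.exp (-(ρ * (unitTorusGeo L i.kk (cvM d L i.m i.kk hL)).dist y y'))) ∧
        HasMaj (BlockNorm.ofBlocks (unitTorusGeo L i.kk (cvM d L i.m i.kk hL)) (liftBlk (fun b : CvX' d L i.m i.kk i.r hL => blockOf (L ^ i.r * L ^ i.kk) (cvM d L i.m i.kk hL) b.1) ι))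
          (BlockNorm.ofBlocks (unitTorusGeo L i.kk (cvM d L i.m i.kk hL)) (liftBlk (fun b : Tor (cvM d L i.m i.kk hL) × Fin (d + 1) => b.1) ι)) (Df i A')
          (fun y y' => KD * (c35 * (L : ℝ) ^ i.m * α₀) * Real.exp (-(ρ * (unitTorusGeo L i.kk (cvM d L i.m i.kk hL)).dist y y'))) ∧
        HasMaj (BlockNorm.ofBlocks (unitTorusGeo L i.kk (cvM d L i.m i.kk hL)) (liftBlk (fun b : Tor (cvM d L i.m i.kk hL) × Fin (d + 1) => b.1) ι)) (CvNorm d L i.m i.kk hL ι) (Ec i A')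
          (fun y y' => KD * (c35 * (L : ℝ) ^ i.m * α₀) * Real.exp (-(ρ * (unitTorusGeo L i.kk (cvM d L i.m i.kk hL)).dist y y'))) ∧
        HasMaj (BlockNorm.ofBlocks (unitTorusGeo L i.kk (cvM d L i.m i.kk hL)) (liftBlk (fun b : Tor (cvM d L i.m i.kk hL) × Fin (d + 1) => b.1) ι))
          (BlockNorm.ofBlocks (unitTorusGeo L i.kk (cvM d L i.m i.kk hL)) (liftBlk (fun b : CvX' d L i.m i.kk i.r hL => blockOf (L ^ i.r * L ^ i.kk) (cvM d L i.m i.kk hL) b.1) ι)) (Ef i A')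
          (fun y y' => KD * (c35 * (L : ℝ) ^ i.m * α₀) * Real.exp (-(ρ * (unitTorusGeo L i.kk (cvM d L i.m i.kk hL)).dist y y'))) ∧
        HasMaj (CvNorm d L i.m i.kk hL ι) (BlockNorm.ofBlocks (unitTorusGeo L i.kk (cvM d L i.m i.kk hL)) (liftBlk (fun b : Tor (cvM d L i.m i.kk hL) × Fin (d + 1) => b.1) ι))
          (Df i A' ∘ₗ pull (liftMap (kingPrV L i.kk i.r (cvM d L i.m i.kk hL)) ι) - Dc i A')
          (fun y y' => KD * ((((L ^ i.kk : ℕ) : ℝ)) ^ (-(1 / 16 : ℝ))) * Real.exp (-(ρ * (unitTorusGeo L i.kk (cvM d L i.m i.kk hL)).dist y y'))) ∧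
        HasMaj (BlockNorm.ofBlocks (unitTorusGeo L i.kk (cvM d L i.m i.kk hL)) (liftBlk (fun b : Tor (cvM d L i.m i.kk hL) × Fin (d + 1) => b.1) ι))
          (BlockNorm.ofBlocks (unitTorusGeo L i.kk (cvM d L i.m i.kk hL)) (liftBlk (fun b : CvX' d L i.m i.kk i.r hL => blockOf (L ^ i.r * L ^ i.kk) (cvM d L i.m i.kk hL) b.1) ι))
          (Ef i A' - pull (liftMap (kingPrV L i.kk i.r (cvM d L i.m i.kk hL)) ι) ∘ₗ Ec i A')
          (fun y y' => KD * ((((L ^ i.kk : ℕ) : ℝ)) ^ (-(1 / 16 : ℝ))) * Real.exp (-(ρ * (unitTorusGeo L i.kk (cvM d L i.m i.kk hL)).dist y y')))) :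
    ∃ w : ℝ, NE2PlusUnit c35 (fun i : SfIdxGE d L w × Finset (Fin (d + 1) → ℤ) => sfInstance d mm ι hL i.1.1) (fun i => foCovCovLam d mm ι a e hL α β j j' Dc Ec Df Ef i.1.1 i.2)
      (fun i => inLamSf d mm ι hL i.1.1 i.2) (fun i => (sfInstance d mm ι hL i.1.1).gc.dist) := by
  have hLpos : 0 < L := Nat.pos_of_ne_zero (NeZero.ne L)
  have hL1 : 1 ≤ L := hLpos
  have hLr : (0 : ℝ) < (L : ℝ) := Nat.cast_pos.mpr hLpos
  have hL1r : (1 : ℝ) ≤ (L : ℝ) := by exact_mod_cast hLpos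
  have hL2 : 2 ≤ L := by omega
  -- the four constant packages
  obtain ⟨ρ, δz, w₀, R₀, Kz, hρ, hδz, hR₀, hKz, HZ⟩ := exists_zCov_letters d mm ι a e hL hL7 ha
  obtain ⟨KD, s₀, hKD, hs₀, HD⟩ := hfam ρ hρ
  obtain ⟨K, δ', ζ₀, hK, hδ', hζ₀, HP⟩ := exDress_deltaCol_letters d (Fintype.card ι) ha hδz
  obtain ⟨C', δ'', hC', hδ'', HC⟩ := covCS_rate_king L hd hL1 (Fintype.card ι) hδ'
  have hε₀ := epsCovC_pos (d := d) L hL1 (Fintype.card ι) hδ'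
  -- the thresholds
  have hκ0 : 0 ≤ basisConst e := basisConst_nonneg e
  let σ : ℝ := 14 * Real.exp 1 * (1 + Fintype.card (Fin (d + 1))) * basisConst e * ((1 + Fintype.card (Fin (d + 1))) * (3 + 2 * ((d : ℝ) + 1)))
  have hσ0 : 0 ≤ σ := by positivity
  let JJ : ℝ := 1 + Fintype.card (Fin (d + 1) ⊕ Fin (d + 1))
  have hJJ0 : 0 ≤ JJ := by positivity
  let W : ℝ := 2 * ((1 + Fintype.card (Fin (d + 1))) * (3 + 2 * ((d : ℝ) + 1)))
  have hW0 : 0 < W := by positivity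
  let aW : ℝ := 1 / (W * c35)
  have haW : 0 < aW := by positivity
  let aR : ℝ := R₀ / (σ * c35 * JJ + 1)
  have haR : 0 < aR := by positivity
  let aζ : ℝ := ζ₀ / (Kz * (basisConst e + 2 * KD + 1) * c35)
  have haζ : 0 < aζ := by positivity
  let a1 : ℝ := 1 / ((basisConst e + 1) * c35)
  have ha1 : 0 < a1 := by positivity
  let aε : ℝ := epsCovC d L (Fintype.card ι) δ' / (K * Kz * (basisConst e + 2 * KD + 1) * c35)
  have haε : 0 < aε := by positivity
  let aD : ℝ := 1 / ((KD + 1) * c35)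
  have haD : 0 < aD := by positivity
  let aS : ℝ := s₀ / c35
  have haS0 : 0 < aS := by positivity
  let a₀ : ℝ := min (min (min (min aW aR) (min (min aζ a1) aε)) aD) aS
  have ha₀ : 0 < a₀ := lt_min (lt_min (lt_min (lt_min haW haR) (lt_min (lt_min haζ ha1) haε)) haD) haS0
  have ha₀W : a₀ ≤ aW := (((min_le_left _ _).trans (min_le_left _ _)).trans (min_le_left _ _)).trans (min_le_left _ _)
  have ha₀R : a₀ ≤ aR := (((min_le_left _ _).trans (min_le_left _ _)).trans (min_le_left _ _)).trans (min_le_right _ _)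
  have ha₀ζ : a₀ ≤ aζ := (((min_le_left _ _).trans (min_le_left _ _)).trans (min_le_right _ _)).trans ((min_le_left _ _).trans (min_le_left _ _))
  have ha₀1 : a₀ ≤ a1 := (((min_le_left _ _).trans (min_le_left _ _)).trans (min_le_right _ _)).trans ((min_le_left _ _).trans (min_le_right _ _))
  have ha₀ε : a₀ ≤ aε := (((min_le_left _ _).trans (min_le_left _ _)).trans (min_le_right _ _)).trans (min_le_right _ _)
  have ha₀D : a₀ ≤ aD := (min_le_left _ _).trans (min_le_right _ _)
  have ha₀S : a₀ ≤ aS := min_le_right _ _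
  refine ⟨max w₀ 1, δ'', a₀, C' * (1 + K * (Kz * (2 + 2 * KD) + 1)) + 1, (L : ℝ) ^ (-(1 / 16 : ℝ)), hδ'', ha₀, by positivity, Real.rpow_pos_of_pos hLr _,
    Real.rpow_lt_one_of_one_lt_of_neg (by exact_mod_cast hL2) (by norm_num), fun i α₀ hα₀ hMa A' hA' _ y y' _ _ => ?_⟩
  -- the index's scalar facts
  have hM : max w₀ 1 ≤ ((L ^ i.1.1.m : ℕ) : ℝ) := i.1.2
  rw [sfInstance_gf_M] at hMa
  have hw₀ : w₀ ≤ ((L ^ i.1.1.m : ℕ) : ℝ) := (le_max_left _ _).trans hM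
  have hx1 : (1 : ℝ) ≤ (L : ℝ) ^ i.1.1.kk := one_le_pow₀ hL1r
  have hxpos : (0 : ℝ) < (L : ℝ) ^ i.1.1.kk := pow_pos hLr _
  have hcast : (((L ^ i.1.1.kk : ℕ) : ℝ)) = (L : ℝ) ^ i.1.1.kk := by push_cast; rfl
  have hLMdvd : ∀ μ, L ∣ cvM d L i.1.1.m i.1.1.kk hL μ := fun μ => by
    show L ∣ 2 * L ^ (i.1.1.m + 1)
    exact Dvd.dvd.mul_left (dvd_pow_self L (Nat.succ_ne_zero _)) 2
  set t : ℝ := ((L : ℝ) ^ i.1.1.kk) ^ (-(1 / 16 : ℝ)) with ht_def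
  have ht0 : 0 ≤ t := Real.rpow_nonneg hxpos.le _
  have hθt : (((L ^ i.1.1.kk : ℕ) : ℝ)) ^ (-(1 / 16 : ℝ)) = t := by rw [hcast]
  have hinv : ((((L ^ i.1.1.kk : ℕ) : ℝ)))⁻¹ ≤ t := by
    rw [hcast, ← Real.rpow_neg_one]; exact Real.rpow_le_rpow_of_exponent_le hx1 (by norm_num)
  have hinv' : ((L : ℝ) ^ i.1.1.kk)⁻¹ ≤ t := by rw [← hcast]; exact hinv
  have hη0 : 0 ≤ ((((L ^ i.1.1.kk : ℕ) : ℝ)))⁻¹ := by positivity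
  have hθ0 : 0 ≤ (((L ^ i.1.1.kk : ℕ) : ℝ)) ^ (-(1 / 16 : ℝ)) := by rw [hθt]; exact ht0
  -- the class at the index and the family's rows there (`r_A ≤ s₀` by the threshold)
  have hrA0 : 0 ≤ c35 * (L : ℝ) ^ i.1.1.m * α₀ := by positivity
  have hrAa : c35 * (L : ℝ) ^ i.1.1.m * α₀ ≤ c35 * a₀ := by
    rw [mul_assoc]; exact mul_le_mul_of_nonneg_left hMa hc35.le
  have hrS : c35 * (L : ℝ) ^ i.1.1.m * α₀ ≤ s₀ := by
    calc c35 * (L : ℝ) ^ i.1.1.m * α₀ ≤ c35 * aS := hrAa.trans (mul_le_mul_of_nonneg_left ha₀S hc35.le)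
      _ = s₀ := by
          show c35 * (s₀ / c35) = s₀
          field_simp
  obtain ⟨hDc, hDf, hEc, hEf, hDd, hEd⟩ := HD i.1.1 α₀ A' hα₀ hrS hA'
  obtain ⟨hskew, h1, h2, h3⟩ := (sfInstance_reg335_iff d mm ι hL i.1.1 c35 α₀ A').1 hA'
  have hconv : ((L : ℝ) ^ i.1.1.kk)⁻¹ * ((L : ℝ) ^ i.1.1.r)⁻¹ = (((L ^ i.1.1.r * L ^ i.1.1.kk : ℕ) : ℝ))⁻¹ := by
    push_cast
    rw [mul_inv, mul_comm]
  have h2' : ∀ μ κ x', ‖A' μ (bshiftEquiv (cvM d L i.1.1.m i.1.1.kk hL) (L ^ i.1.1.r * L ^ i.1.1.kk) κ x') - A' μ x'‖ ≤ c35 * (L : ℝ) ^ i.1.1.m * α₀ * ((((L ^ i.1.1.r * L ^ i.1.1.kk : ℕ) : ℝ))⁻¹) :=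
    fun μ κ x' => (h2 μ κ x').trans_eq (by rw [hconv])
  have h3' : ∀ μ κ x', ‖(A' μ (bshiftEquiv (cvM d L i.1.1.m i.1.1.kk hL) (L ^ i.1.1.r * L ^ i.1.1.kk) κ x') - A' μ x') -
      (A' μ (bshiftEquiv (cvM d L i.1.1.m i.1.1.kk hL) (L ^ i.1.1.r * L ^ i.1.1.kk) κ ((bshiftEquiv (cvM d L i.1.1.m i.1.1.kk hL) (L ^ i.1.1.r * L ^ i.1.1.kk) μ).symm x')) -
        A' μ ((bshiftEquiv (cvM d L i.1.1.m i.1.1.kk hL) (L ^ i.1.1.r * L ^ i.1.1.kk) μ).symm x'))‖ ≤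
      c35 * (L : ℝ) ^ i.1.1.m * α₀ * ((((L ^ i.1.1.r * L ^ i.1.1.kk : ℕ) : ℝ))⁻¹) * ((((L ^ i.1.1.r * L ^ i.1.1.kk : ℕ) : ℝ))⁻¹) :=
    fun μ κ x' => (h3 μ κ x').trans_eq (by rw [hconv])
  have hr2 : 2 * ((1 + Fintype.card (Fin (d + 1))) * ((3 + 2 * ((d : ℝ) + 1)) * (c35 * (L : ℝ) ^ i.1.1.m * α₀))) ≤ 1 := by
    have hWa : W * (c35 * a₀) ≤ 1 := by
      calc W * (c35 * a₀) ≤ W * (c35 * aW) := mul_le_mul_of_nonneg_left (mul_le_mul_of_nonneg_left ha₀W hc35.le) hW0.le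
        _ = 1 := by
          show W * (c35 * (1 / (W * c35))) = 1
          field_simp
    calc 2 * ((1 + Fintype.card (Fin (d + 1))) * ((3 + 2 * ((d : ℝ) + 1)) * (c35 * (L : ℝ) ^ i.1.1.m * α₀))) = W * (c35 * (L : ℝ) ^ i.1.1.m * α₀) := by ring
      _ ≤ W * (c35 * a₀) := mul_le_mul_of_nonneg_left hrAa hW0.le
      _ ≤ 1 := hWa
  have hscale : 14 * Real.exp 1 * (1 + Fintype.card (Fin (d + 1))) * basisConst e * ((1 + Fintype.card (Fin (d + 1))) * ((3 + 2 * ((d : ℝ) + 1)) * (c35 * (L : ℝ) ^ i.1.1.m * α₀))) =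
      σ * (c35 * (L : ℝ) ^ i.1.1.m * α₀) := by ring
  have hSle : σ * (c35 * (L : ℝ) ^ i.1.1.m * α₀) ≤ σ * (c35 * a₀) := mul_le_mul_of_nonneg_left hrAa hσ0
  have hRle : 14 * Real.exp 1 * (1 + Fintype.card (Fin (d + 1))) * basisConst e * ((1 + Fintype.card (Fin (d + 1))) * ((3 + 2 * ((d : ℝ) + 1)) * (c35 * (L : ℝ) ^ i.1.1.m * α₀))) *
      (1 + Fintype.card (Fin (d + 1) ⊕ Fin (d + 1))) ≤ R₀ := by
    rw [hscale]
    have hRa : σ * (c35 * aR) * JJ ≤ R₀ := by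
      have hden : 0 < σ * c35 * JJ + 1 := by positivity
      calc σ * (c35 * aR) * JJ = R₀ * (σ * c35 * JJ) / (σ * c35 * JJ + 1) := by
            show σ * (c35 * (R₀ / (σ * c35 * JJ + 1))) * JJ = R₀ * (σ * c35 * JJ) / (σ * c35 * JJ + 1)
            field_simp
        _ ≤ R₀ * (σ * c35 * JJ + 1) / (σ * c35 * JJ + 1) := by gcongr; linarith
        _ = R₀ := by field_simp
    calc σ * (c35 * (L : ℝ) ^ i.1.1.m * α₀) * JJ ≤ σ * (c35 * a₀) * JJ := mul_le_mul_of_nonneg_right hSle hJJ0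
      _ ≤ σ * (c35 * aR) * JJ := mul_le_mul_of_nonneg_right (mul_le_mul_of_nonneg_left (mul_le_mul_of_nonneg_left ha₀R hc35.le) hσ0) hJJ0
      _ ≤ R₀ := hRa
  -- the margins
  have hκr1 : basisConst e * (c35 * (L : ℝ) ^ i.1.1.m * α₀) ≤ 1 := by
    calc basisConst e * (c35 * (L : ℝ) ^ i.1.1.m * α₀) ≤ (basisConst e + 1) * (c35 * a1) :=
          mul_le_mul (by linarith) (hrAa.trans (mul_le_mul_of_nonneg_left ha₀1 hc35.le)) hrA0 (by positivity)
      _ = 1 := by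
          show (basisConst e + 1) * (c35 * (1 / ((basisConst e + 1) * c35))) = 1
          field_simp
  have hDr1 : KD * (c35 * (L : ℝ) ^ i.1.1.m * α₀) ≤ 1 := by
    calc KD * (c35 * (L : ℝ) ^ i.1.1.m * α₀) ≤ (KD + 1) * (c35 * aD) :=
          mul_le_mul (by linarith) (hrAa.trans (mul_le_mul_of_nonneg_left ha₀D hc35.le)) hrA0 (by positivity)
      _ = 1 := by
          show (KD + 1) * (c35 * (1 / ((KD + 1) * c35))) = 1
          field_simp
  have hre : Kz * (basisConst e * (c35 * (L : ℝ) ^ i.1.1.m * α₀) + KD * (c35 * (L : ℝ) ^ i.1.1.m * α₀) + KD * (c35 * (L : ℝ) ^ i.1.1.m * α₀)) =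
      Kz * (basisConst e + 2 * KD) * (c35 * (L : ℝ) ^ i.1.1.m * α₀) := by ring
  have hζle : Kz * (basisConst e * (c35 * (L : ℝ) ^ i.1.1.m * α₀) + KD * (c35 * (L : ℝ) ^ i.1.1.m * α₀) + KD * (c35 * (L : ℝ) ^ i.1.1.m * α₀)) ≤ ζ₀ := by
    rw [hre]
    calc Kz * (basisConst e + 2 * KD) * (c35 * (L : ℝ) ^ i.1.1.m * α₀) ≤ Kz * (basisConst e + 2 * KD + 1) * (c35 * aζ) :=
          mul_le_mul (mul_le_mul_of_nonneg_left (by linarith) hKz.le) (hrAa.trans (mul_le_mul_of_nonneg_left ha₀ζ hc35.le)) hrA0 (by positivity)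
      _ = ζ₀ := by
          show Kz * (basisConst e + 2 * KD + 1) * (c35 * (ζ₀ / (Kz * (basisConst e + 2 * KD + 1) * c35))) = ζ₀
          field_simp
  have hεle : K * (Kz * (basisConst e * (c35 * (L : ℝ) ^ i.1.1.m * α₀) + KD * (c35 * (L : ℝ) ^ i.1.1.m * α₀) + KD * (c35 * (L : ℝ) ^ i.1.1.m * α₀))) ≤ epsCovC d L (Fintype.card ι) δ' := by
    rw [hre]
    calc K * (Kz * (basisConst e + 2 * KD) * (c35 * (L : ℝ) ^ i.1.1.m * α₀)) ≤ K * (Kz * (basisConst e + 2 * KD + 1) * (c35 * aε)) :=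
          mul_le_mul_of_nonneg_left (mul_le_mul (mul_le_mul_of_nonneg_left (by linarith) hKz.le) (hrAa.trans (mul_le_mul_of_nonneg_left ha₀ε hc35.le)) hrA0 (by positivity)) hK.le
      _ = epsCovC d L (Fintype.card ι) δ' := by
          show K * (Kz * (basisConst e + 2 * KD + 1) * (c35 * (epsCovC d L (Fintype.card ι) δ' / (K * Kz * (basisConst e + 2 * KD + 1) * c35)))) = epsCovC d L (Fintype.card ι) δ'
          field_simp
  have hρD0 : 0 ≤ KD * (c35 * (L : ℝ) ^ i.1.1.m * α₀) := by positivity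
  have hτD0 : 0 ≤ KD * ((((L ^ i.1.1.kk : ℕ) : ℝ)) ^ (-(1 / 16 : ℝ))) := mul_nonneg hKD hθ0
  have hζ0 : 0 ≤ Kz * (basisConst e * (c35 * (L : ℝ) ^ i.1.1.m * α₀) + KD * (c35 * (L : ℝ) ^ i.1.1.m * α₀) + KD * (c35 * (L : ℝ) ^ i.1.1.m * α₀)) := by positivity
  have hτ0 : 0 ≤ Kz * ((((L ^ i.1.1.kk : ℕ) : ℝ)) ^ (-(1 / 16 : ℝ)) + basisConst e * (c35 * (L : ℝ) ^ i.1.1.m * α₀) * ((((L ^ i.1.1.kk : ℕ) : ℝ))⁻¹) +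
      KD * ((((L ^ i.1.1.kk : ℕ) : ℝ)) ^ (-(1 / 16 : ℝ))) + KD * ((((L ^ i.1.1.kk : ℕ) : ℝ)) ^ (-(1 / 16 : ℝ)))) := by positivity
  -- (Q-2): the three letters of the covariantly averaged matrices
  obtain ⟨hZ, hZ', hZZ⟩ := HZ i.1.1.m i.1.1.kk i.1.1.r i.1.1.one_le hw₀ he A' hskew (c35 * (L : ℝ) ^ i.1.1.m * α₀) hrA0 h1 h2' h3' hr2 hRle
    (Dc i.1.1 A') (Ec i.1.1 A') (Df i.1.1 A') (Ef i.1.1 A')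
    (KD * (c35 * (L : ℝ) ^ i.1.1.m * α₀)) (KD * (c35 * (L : ℝ) ^ i.1.1.m * α₀)) (KD * ((((L ^ i.1.1.kk : ℕ) : ℝ)) ^ (-(1 / 16 : ℝ)))) (KD * ((((L ^ i.1.1.kk : ℕ) : ℝ)) ^ (-(1 / 16 : ℝ))))
    hρD0 hDr1 hρD0 hDr1 hτD0 hτD0 hDc hDf hEc hEf hDd hEd
  have hLk : 1 ≤ L ^ i.1.1.kk := Nat.one_le_pow _ _ hLpos
  have hLrr : 1 ≤ L ^ i.1.1.r := Nat.one_le_pow _ _ hLpos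
  -- (H): the three letters of the exact perturbation (rate `δ′`)
  obtain ⟨-, -, hP1, hP2, hP12⟩ := HP (cvM d L i.1.1.m i.1.1.kk hL) ι le_rfl (L ^ i.1.1.kk) (L ^ i.1.1.r * L ^ i.1.1.kk) (L ^ i.1.1.r) hLk hLrr rfl
    (zCovC d mm ι a e hL i.1.1.m i.1.1.kk i.1.1.r A' (Dc i.1.1 A') (Ec i.1.1 A')) (zCovF d mm ι a e hL i.1.1.m i.1.1.kk i.1.1.r A' (Df i.1.1 A') (Ef i.1.1 A')) _ _ hζ0 hζle hτ0 hZ hZ' hZZ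
  have hKζ0 : 0 ≤ K * (Kz * (basisConst e * (c35 * (L : ℝ) ^ i.1.1.m * α₀) + KD * (c35 * (L : ℝ) ^ i.1.1.m * α₀) + KD * (c35 * (L : ℝ) ^ i.1.1.m * α₀))) := by positivity
  have hKτ0 : 0 ≤ K * (Kz * ((((L ^ i.1.1.kk : ℕ) : ℝ)) ^ (-(1 / 16 : ℝ)) + basisConst e * (c35 * (L : ℝ) ^ i.1.1.m * α₀) * ((((L ^ i.1.1.kk : ℕ) : ℝ))⁻¹) +
      KD * ((((L ^ i.1.1.kk : ℕ) : ℝ)) ^ (-(1 / 16 : ℝ))) + KD * ((((L ^ i.1.1.kk : ℕ) : ℝ)) ^ (-(1 / 16 : ℝ)))) + ((L ^ i.1.1.kk : ℕ) : ℝ)⁻¹) := by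
    positivity
  -- (Ð-3): the η-rate of the coloured Dirichlet covariance
  set M := cvM d L i.1.1.m i.1.1.kk hL with hMdef
  set pp : B4.Idx (pbox M) (d + 1) × ι := ((⟨rep M y, rep_mem_pbox M y⟩, α), j) with hpp
  set qq : B4.Idx (pbox M) (d + 1) × ι := ((⟨rep M y', rep_mem_pbox M y'⟩, β), j') with hqq
  have hcov := HC M hLMdvd (lamFree L M i.2) (lamFree_subset L M i.2) ι le_rfl i.1.1.kk i.1.1.r _ _ _ _ hKζ0 hεle hKτ0 hP1 hP2 hP12 pp qq
  have hcd : cdist M ι pp qq = tdistT M y y' := by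
    rw [cdist_eq, hpp, hqq]
    exact pdist_rep_rep M (one_le_M M) y y'
  rw [hcd] at hcov
  -- the readout: unit distance, clean rate `θ^k = (L^k)^{−1/16}`
  show |(foCovCovLam d mm ι a e hL α β j j' Dc Ec Df Ef i.1.1 i.2).ker A' y y'| ≤ (C' * (1 + K * (Kz * (2 + 2 * KD) + 1)) + 1) * Real.exp (-(δ'' * tdistT M y y')) * ((L : ℝ) ^ (-(1 / 16 : ℝ))) ^ i.1.1.kk
  have hrpow : ((L : ℝ) ^ i.1.1.kk) ^ (-(1 / 16 : ℝ)) = ((L : ℝ) ^ (-(1 / 16 : ℝ))) ^ i.1.1.kk := by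
    rw [← Real.rpow_natCast, ← Real.rpow_mul hLr.le, mul_comm, Real.rpow_mul hLr.le, Real.rpow_natCast]
  rw [foCovCovLam_ker, ← hrpow]
  refine hcov.trans ?_
  have hE := Real.exp_nonneg (-(δ'' * tdistT M y y'))
  have hamp : C' * (((L : ℝ) ^ i.1.1.kk)⁻¹ + K * (Kz * ((((L ^ i.1.1.kk : ℕ) : ℝ)) ^ (-(1 / 16 : ℝ)) + basisConst e * (c35 * (L : ℝ) ^ i.1.1.m * α₀) * ((((L ^ i.1.1.kk : ℕ) : ℝ))⁻¹) +
      KD * ((((L ^ i.1.1.kk : ℕ) : ℝ)) ^ (-(1 / 16 : ℝ))) + KD * ((((L ^ i.1.1.kk : ℕ) : ℝ)) ^ (-(1 / 16 : ℝ)))) + ((L ^ i.1.1.kk : ℕ) : ℝ)⁻¹)) ≤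
      (C' * (1 + K * (Kz * (2 + 2 * KD) + 1)) + 1) * t := by
    rw [hθt]
    have h2 : basisConst e * (c35 * (L : ℝ) ^ i.1.1.m * α₀) * ((((L ^ i.1.1.kk : ℕ) : ℝ))⁻¹) ≤ t := by
      calc basisConst e * (c35 * (L : ℝ) ^ i.1.1.m * α₀) * ((((L ^ i.1.1.kk : ℕ) : ℝ))⁻¹) ≤ 1 * t := mul_le_mul hκr1 hinv hη0 zero_le_one
        _ = t := one_mul t
    have h4 : Kz * (t + basisConst e * (c35 * (L : ℝ) ^ i.1.1.m * α₀) * ((((L ^ i.1.1.kk : ℕ) : ℝ))⁻¹) + KD * t + KD * t) ≤ Kz * (t + t + KD * t + KD * t) :=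
      mul_le_mul_of_nonneg_left (by linarith) hKz.le
    have h5 : K * (Kz * (t + basisConst e * (c35 * (L : ℝ) ^ i.1.1.m * α₀) * ((((L ^ i.1.1.kk : ℕ) : ℝ))⁻¹) + KD * t + KD * t) + ((L ^ i.1.1.kk : ℕ) : ℝ)⁻¹) ≤ K * (Kz * (2 + 2 * KD) + 1) * t := by
      calc K * (Kz * (t + basisConst e * (c35 * (L : ℝ) ^ i.1.1.m * α₀) * ((((L ^ i.1.1.kk : ℕ) : ℝ))⁻¹) + KD * t + KD * t) + ((L ^ i.1.1.kk : ℕ) : ℝ)⁻¹) ≤ K * (Kz * (t + t + KD * t + KD * t) + t) :=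
            mul_le_mul_of_nonneg_left (add_le_add h4 hinv) hK.le
        _ = K * (Kz * (2 + 2 * KD) + 1) * t := by ring
    calc C' * (((L : ℝ) ^ i.1.1.kk)⁻¹ + K * (Kz * (t + basisConst e * (c35 * (L : ℝ) ^ i.1.1.m * α₀) * ((((L ^ i.1.1.kk : ℕ) : ℝ))⁻¹) + KD * t + KD * t) + ((L ^ i.1.1.kk : ℕ) : ℝ)⁻¹))
        ≤ C' * (t + K * (Kz * (2 + 2 * KD) + 1) * t) := mul_le_mul_of_nonneg_left (add_le_add hinv' h5) hC'.le
      _ = (C' * (1 + K * (Kz * (2 + 2 * KD) + 1))) * t := by ring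
      _ ≤ (C' * (1 + K * (Kz * (2 + 2 * KD) + 1)) + 1) * t := mul_le_mul_of_nonneg_right (by linarith) ht0
  calc C' * (((L : ℝ) ^ i.1.1.kk)⁻¹ + K * (Kz * ((((L ^ i.1.1.kk : ℕ) : ℝ)) ^ (-(1 / 16 : ℝ)) + basisConst e * (c35 * (L : ℝ) ^ i.1.1.m * α₀) * ((((L ^ i.1.1.kk : ℕ) : ℝ))⁻¹) +
        KD * ((((L ^ i.1.1.kk : ℕ) : ℝ)) ^ (-(1 / 16 : ℝ))) + KD * ((((L ^ i.1.1.kk : ℕ) : ℝ)) ^ (-(1 / 16 : ℝ)))) + ((L ^ i.1.1.kk : ℕ) : ℝ)⁻¹)) * Real.exp (-(δ'' * tdistT M y y'))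
      ≤ ((C' * (1 + K * (Kz * (2 + 2 * KD) + 1)) + 1) * t) * Real.exp (-(δ'' * tdistT M y y')) := mul_le_mul_of_nonneg_right hamp hE
    _ = _ := by rw [ht_def]; ring

end UnitLayer

end Summit.QuantumFields.YangMills.BalabanUVNodes.N15.SiteLayerSf

end
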